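import Summits.Ventures.CertifiedManyBodySolver.Theorems.TcThermcert1FreeGasArcEstimate
import HarnessLib

/-!
# Free-gas (`U = 0`) sector witness for TcThermcert1's K1 family — part 9 (last): the analytic core PROVED and the unconditional rung / K1-twin

`esymmLogTwistInsensitive_holds : EsymmLogTwistInsensitive` (with `θ₁ = π`, `ε_L = 128 B L⁴e^{−aL} + 32 L²e^{−cL²}`: sector arithmetic
`halfCount_bounds`, `fugacity_window`, `delta_bound`, `rate_tendsto`, then `Inputs.abs_log_esymmW_sub_le`), hence the UNCONDITIONAL
theorems **`freeGas_rung : 0 < β → ObsThermalStiffnessSeqCeilingAtBeta 0 0 (7/8) β 0`** and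
**`freeGas_K1twin : ObsThermalStiffnessSeqCeilingAtBeta 0 0 (7/8) 10 (1/8)`** (K1 = `TcThermcert1.ThermalStiffnessCeilingU8b10_le_1o8` reads
`ObsThermalStiffnessSeqCeilingAtBeta 0 8 (7/8) 10 (1/8)`: this is its solver-free twin, a BC5-type witness of weakness for the FAMILY).
HONEST FRAMING: statements about the FREE (`U = 0`) twisted torus gas and about symmetric functions of explicit reals;
nothing here touches `U = 8`; superconductivity in the Hubbard model is NOT proved (or disproved) by any of this.
Provenance: landed form of the crux workfile `Cruxes/ThermalStiffnessCeilingU8b10_le_1o8/FreeGasArcSkeleton.lean` v4.1 (tree 80a90c42bbb7)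
+ `FreeGasArcInputs.lean` (d3c3c585d14e), planner `hubbard-floor-idea-rescuer` g5, card `free-gas-arc-darroch` (crit-1 KEEP);
hubbard-floor support target ST-K1-U0-1, `--supports stmt-Ventures-26381` (TcThermcert1 crux K1). Split into ≤ 400-line modules
`Theorems/TcThermcert1FreeGas*.lean`.
-/

noncomputable section

namespace Summit.Ventures.CertifiedManyBodySolver.Theorems.FreeGasArc

open Filter Topology Set Real Finset
open Summit.Ventures.CertifiedManyBodySolver.Observables
open Literature.MathematicalPhysics.QuantumLattice
open Literature.Probability.LatticeModels (TorusSite latticeMomentum)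
open scoped BigOperators

/-- Arithmetic of the sector: `1 ≤ M < L²`, `M + 1 ≤ e(L² − M)`, `L² − M + 1 ≤ e M` for `M = ⌊7L²/16⌋`, `L ≥ 3`. -/
theorem halfCount_bounds {L : ℕ} (hL : 3 ≤ L) :
    1 ≤ halfCount L ∧ halfCount L < L ^ 2 ∧
      ((halfCount L : ℝ) + 1) ≤ Real.exp 1 * ((L : ℝ) ^ 2 - halfCount L) ∧
      ((L : ℝ) ^ 2 - halfCount L + 1) ≤ Real.exp 1 * halfCount L := by
  have hL' : (3 : ℝ) ≤ L := by exact_mod_cast hL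
  have hn : (9 : ℝ) ≤ (L : ℝ) ^ 2 := by nlinarith
  have h78 : (1 - (1 - 7 / 8 : ℝ)) * (L : ℝ) ^ 2 / 2 = 7 * (L : ℝ) ^ 2 / 16 := by ring
  have hfl : (halfCount L : ℝ) ≤ 7 * (L : ℝ) ^ 2 / 16 := by
    rw [halfCount, ← h78]
    exact Nat.floor_le (by positivity)
  have hfl2 : 7 * (L : ℝ) ^ 2 / 16 < (halfCount L : ℝ) + 1 := by
    rw [halfCount, ← h78]
    exact_mod_cast Nat.lt_floor_add_one _
  have he : (2.7 : ℝ) < Real.exp 1 := lt_trans (by norm_num) Real.exp_one_gt_d9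
  refine ⟨?_, ?_, ?_, ?_⟩
  · have : (1 : ℝ) ≤ halfCount L := by linarith
    exact_mod_cast this
  · have : (halfCount L : ℝ) < (L : ℝ) ^ 2 := by nlinarith
    exact_mod_cast this
  · have hD : 0 ≤ (L : ℝ) ^ 2 - halfCount L := by linarith
    nlinarith [mul_le_mul_of_nonneg_right he.le hD]
  · have hM0 : 0 ≤ (halfCount L : ℝ) := by positivity
    nlinarith [mul_le_mul_of_nonneg_right he.le hM0]

/-- The rate `ε_L = 128 B L⁴ e^{−aL} + 32 L² e^{−cL²}` tends to `0`. -/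
theorem rate_tendsto {a c : ℝ} (B : ℝ) (ha : 0 < a) (hc : 0 < c) :
    Tendsto (fun L : ℕ => 128 * B * (L : ℝ) ^ 4 * Real.exp (-(a * L)) +
      32 * (L : ℝ) ^ 2 * Real.exp (-(c * (L : ℝ) ^ 2))) atTop (𝓝 0) := by
  have h1 : Tendsto (fun L : ℕ => a * (L : ℝ)) atTop atTop := tendsto_natCast_atTop_atTop.const_mul_atTop ha
  have h2 : Tendsto (fun L : ℕ => c * (L : ℝ) ^ 2) atTop atTop :=
    ((tendsto_pow_atTop two_ne_zero).comp tendsto_natCast_atTop_atTop).const_mul_atTop hc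
  have h3 := (Real.tendsto_pow_mul_exp_neg_atTop_nhds_zero 4).comp h1
  have h4 := (Real.tendsto_pow_mul_exp_neg_atTop_nhds_zero 1).comp h2
  have h5 := (h3.const_mul (128 * B / a ^ 4)).add (h4.const_mul (32 / c))
  simp only [mul_zero, add_zero] at h5
  refine h5.congr' (Filter.Eventually.of_forall fun L => ?_)
  simp only [Function.comp]
  field_simp

/-- The fugacity window: the pinning inequalities at `M = ⌊7L²/16⌋`, `L ≥ 3`, force `|log t| ≤ 4β + 1`. -/
theorem fugacity_window {β t : ℝ} {L : ℕ} (hβ : 0 < β) (ht : 0 < t) (hL3 : 3 ≤ L)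
    (hp1 : ((L : ℝ) ^ 2 - halfCount L) * Real.exp (-(4 * β)) * t ≤ (halfCount L : ℝ) + 1)
    (hp2 : (halfCount L : ℝ) ≤ ((L : ℝ) ^ 2 - halfCount L + 1) * Real.exp (4 * β) * t) :
    -4 * β - 1 ≤ Real.log t ∧ Real.log t ≤ 4 * β + 1 := by
  obtain ⟨hM1, hMn, hpin1, hpin2⟩ := halfCount_bounds hL3
  have hD : 0 < (L : ℝ) ^ 2 - halfCount L := by
    have : (halfCount L : ℝ) < (L : ℝ) ^ 2 := by exact_mod_cast (show halfCount L < L ^ 2 from hMn)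
    linarith
  have hMpos : 0 < (halfCount L : ℝ) := by exact_mod_cast hM1
  have _hβ := hβ
  constructor
  · rw [Real.le_log_iff_exp_le ht]
    have h0 : (0 : ℝ) ≤ Real.exp (4 * β) * t := by positivity
    have h1 : (halfCount L : ℝ) * 1 ≤ (halfCount L : ℝ) * (Real.exp 1 * Real.exp (4 * β) * t) := by
      have := mul_le_mul_of_nonneg_right hpin2 h0
      nlinarith
    have h2 : 1 ≤ Real.exp 1 * Real.exp (4 * β) * t := le_of_mul_le_mul_left h1 hMpos
    have h3 : Real.exp (-4 * β - 1) * (Real.exp 1 * Real.exp (4 * β)) = 1 := by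
      rw [← Real.exp_add, ← Real.exp_add, show -4 * β - 1 + (1 + 4 * β) = 0 by ring, Real.exp_zero]
    calc Real.exp (-4 * β - 1) = Real.exp (-4 * β - 1) * 1 := (mul_one _).symm
      _ ≤ Real.exp (-4 * β - 1) * (Real.exp 1 * Real.exp (4 * β) * t) :=
          mul_le_mul_of_nonneg_left h2 (Real.exp_pos _).le
      _ = t := by
          rw [show Real.exp 1 * Real.exp (4 * β) * t = (Real.exp 1 * Real.exp (4 * β)) * t by ring,
            ← mul_assoc, h3, one_mul]
  · rw [Real.log_le_iff_le_exp ht]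
    have h1 : ((L : ℝ) ^ 2 - halfCount L) * (Real.exp (-(4 * β)) * t) ≤
        ((L : ℝ) ^ 2 - halfCount L) * Real.exp 1 := by nlinarith
    have h2 : Real.exp (-(4 * β)) * t ≤ Real.exp 1 := le_of_mul_le_mul_left h1 hD
    have h3 : t = Real.exp (4 * β) * (Real.exp (-(4 * β)) * t) := by
      rw [← mul_assoc, ← Real.exp_add]
      simp
    rw [h3, Real.exp_add]
    exact mul_le_mul_of_nonneg_left h2 (Real.exp_pos _).le

/-- The arc error `δ_L = L · 4LB/(e^{aL} − 1)` is nonnegative and `8(L² + 1)δ_L ≤ 128 B L⁴ e^{−aL}` once `aL ≥ 1`. -/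
theorem delta_bound {a B : ℝ} {L : ℕ} (hB : 0 ≤ B) (haL : 1 ≤ a * L) (hL1 : (1 : ℝ) ≤ L) :
    0 ≤ (L : ℝ) * (4 * L * B / (Real.exp (a * L) - 1)) ∧
      8 * ((L : ℝ) ^ 2 + 1) * ((L : ℝ) * (4 * L * B / (Real.exp (a * L) - 1))) ≤
        128 * B * (L : ℝ) ^ 4 * Real.exp (-(a * L)) := by
  have hexp2 : 2 ≤ Real.exp (a * L) := by
    have := Real.exp_le_exp.2 haL
    have he : (2 : ℝ) < Real.exp 1 := lt_trans (by norm_num) Real.exp_one_gt_d9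
    linarith
  have hden : 0 < Real.exp (a * L) - 1 := by linarith
  have hL0 : (0 : ℝ) ≤ L := by linarith
  refine ⟨by positivity, ?_⟩
  have hinv : 1 / (Real.exp (a * L) - 1) ≤ 2 * Real.exp (-(a * L)) := by
    rw [div_le_iff₀ hden, Real.exp_neg]
    have hpos : 0 < Real.exp (a * L) := Real.exp_pos _
    have hin : (Real.exp (a * L))⁻¹ * Real.exp (a * L) = 1 := inv_mul_cancel₀ hpos.ne'
    nlinarith [hin, hexp2, inv_pos.2 hpos, mul_le_mul_of_nonneg_left hexp2 (inv_pos.2 hpos).le]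
  have hL21 : (L : ℝ) ^ 2 + 1 ≤ 2 * (L : ℝ) ^ 2 := by nlinarith
  have hδ' : (L : ℝ) * (4 * L * B / (Real.exp (a * L) - 1)) =
      4 * (L : ℝ) ^ 2 * B * (1 / (Real.exp (a * L) - 1)) := by
    field_simp
  rw [hδ']
  calc 8 * ((L : ℝ) ^ 2 + 1) * (4 * (L : ℝ) ^ 2 * B * (1 / (Real.exp (a * L) - 1)))
      ≤ 8 * (2 * (L : ℝ) ^ 2) * (4 * (L : ℝ) ^ 2 * B * (2 * Real.exp (-(a * L)))) := by gcongr
    _ = 128 * B * (L : ℝ) ^ 4 * Real.exp (-(a * L)) := by ring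

/-- **STUB 2 IS A THEOREM (v3).** The analytic core `EsymmLogTwistInsensitive` holds: proved from the generic inputs
of `FreeGasArcInputs` (contour formula, mode fugacity + polynomial floor + pinning, arc trapezoid shift, strip
analyticity, off-arc Gaussian decay, ratio-to-log step) and the model-specific `freeBandOccupationVariance`, with
`θ₁ = π` and `ε_L = 128 B L⁴ e^{−aL} + 32 L² e^{−cL²}`. -/
theorem esymmLogTwistInsensitive_holds : EsymmLogTwistInsensitive := by
  intro β hβ
  obtain ⟨a, ha, B, hB, hstrip⟩ := FreeGasArc.Inputs.freeBandLogStrip_holds β hβ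
  obtain ⟨c, hc, L₁, hvar⟩ := freeBandOccupationVariance β hβ
  -- the rate function and the threshold
  have hε_tendsto := rate_tendsto B ha hc
  obtain ⟨L₂, hL₂⟩ := Filter.eventually_atTop.1 (hε_tendsto.eventually (eventually_lt_nhds zero_lt_one))
  refine ⟨π, Real.pi_pos, _, hε_tendsto, max (max L₁ L₂) (max 3 (⌈1 / a⌉₊ + 1)), ?_⟩
  intro L _ hL θ hθ
  have hL1 : L₁ ≤ L := le_trans (le_max_left _ _) (le_trans (le_max_left _ _) hL)
  have hL2 : L₂ ≤ L := le_trans (le_max_right _ _) (le_trans (le_max_left _ _) hL)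
  have hL3 : 3 ≤ L := le_trans (le_max_left _ _) (le_trans (le_max_right _ _) hL)
  have hLa : ⌈1 / a⌉₊ + 1 ≤ L := le_trans (le_max_right _ _) (le_trans (le_max_right _ _) hL)
  have hL1' : (1 : ℝ) ≤ L := by exact_mod_cast le_trans (by norm_num) hL3
  have haL : 1 ≤ a * L := by
    have h1 : (1 / a : ℝ) ≤ ⌈1 / a⌉₊ := Nat.le_ceil _
    have h2 : ((⌈1 / a⌉₊ + 1 : ℕ) : ℝ) ≤ L := by exact_mod_cast hLa
    push_cast at h2
    have h3 : 1 / a < L := by linarith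
    rw [div_lt_iff₀ ha] at h3
    linarith
  -- weights: positivity and the band window `[e^{−4β}, e^{4β}]`
  have hwpos : ∀ (θ' : ℝ) (k : TorusSite 2 L), 0 < freeWeight L β θ' k := fun _ _ => Real.exp_pos _
  have hwb : ∀ (θ' : ℝ) (k : TorusSite 2 L), Real.exp (-(4 * β)) ≤ freeWeight L β θ' k := by
    intro θ' k
    have hξ := abs_le.1 (abs_twistedBand_le L θ' k)
    exact Real.exp_le_exp.2 (by nlinarith [hξ.1, hξ.2, hβ])
  have hwB : ∀ (θ' : ℝ) (k : TorusSite 2 L), freeWeight L β θ' k ≤ Real.exp (4 * β) := by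
    intro θ' k
    have hξ := abs_le.1 (abs_twistedBand_le L θ' k)
    exact Real.exp_le_exp.2 (by nlinarith [hξ.1, hξ.2, hβ])
  have hcardN : Fintype.card (TorusSite 2 L) = L ^ 2 := by
    rw [Fintype.card_fun, ZMod.card, Fintype.card_fin]
  have hcard : (Fintype.card (TorusSite 2 L) : ℝ) = (L : ℝ) ^ 2 := by
    rw [hcardN]
    push_cast
    ring
  obtain ⟨hM1, hMn, -, -⟩ := halfCount_bounds hL3
  -- the mode fugacity of the untwisted weights, pinned to the window
  obtain ⟨t, ht, hmode, -, hp1, hp2⟩ := FreeGasArc.Inputs.exists_modeFugacity_pinned (freeWeight L β 0)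
    (Real.exp_pos (-(4 * β))) (hwb 0) (hwB 0) hM1 (by rw [hcardN]; exact hMn)
  rw [hcard] at hp1 hp2
  obtain ⟨hs1, hs2⟩ := fugacity_window hβ ht hL3 hp1 hp2
  have hts : Real.exp (Real.log t) = t := Real.exp_log ht
  -- δ, K and their smallness
  obtain ⟨hδ0, hδ_le⟩ := delta_bound (a := a) hB haL hL1'
  have hK2_le : 16 * ((L : ℝ) ^ 2 + 1) * Real.exp (-(c * (L : ℝ) ^ 2)) ≤
      32 * (L : ℝ) ^ 2 * Real.exp (-(c * (L : ℝ) ^ 2)) := by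
    have hL21 : 16 * ((L : ℝ) ^ 2 + 1) ≤ 32 * (L : ℝ) ^ 2 := by nlinarith [hL1']
    exact mul_le_mul_of_nonneg_right hL21 (Real.exp_pos (-(c * (L : ℝ) ^ 2))).le
  have hεL := hL₂ L hL2
  have h16 : 0 ≤ 16 * ((L : ℝ) ^ 2 + 1) * Real.exp (-(c * (L : ℝ) ^ 2)) := by positivity
  have h8 : (L : ℝ) * (4 * L * B / (Real.exp (a * L) - 1)) ≤
      8 * ((L : ℝ) ^ 2 + 1) * ((L : ℝ) * (4 * L * B / (Real.exp (a * L) - 1))) := by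
    nlinarith [mul_nonneg hδ0 (sq_nonneg (L : ℝ))]
  have hδ1 : (L : ℝ) * (4 * L * B / (Real.exp (a * L) - 1)) ≤ 1 := by linarith
  have hK0 : 0 ≤ 2 * ((L : ℝ) * (4 * L * B / (Real.exp (a * L) - 1))) + 4 * Real.exp (-(c * (L : ℝ) ^ 2)) := by
    positivity
  have hsmall : (((Fintype.card (TorusSite 2 L) : ℝ)) + 1) *
      (2 * ((L : ℝ) * (4 * L * B / (Real.exp (a * L) - 1))) + 4 * Real.exp (-(c * (L : ℝ) ^ 2))) ≤ 1 / 2 := by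
    rw [hcard]
    linarith
  -- strip facts at `s = log t`
  have hstripφ : ∀ φ' : ℝ, |φ'| ≤ π / 2 → ∀ p₂ : ℝ,
      (∀ z : ℂ, lineLog β (Real.log t) φ' p₂ (z + 2 * π) = lineLog β (Real.log t) φ' p₂ z) ∧
      DifferentiableOn ℂ (lineLog β (Real.log t) φ' p₂) {z : ℂ | |z.im| < a} ∧
      (∀ z : ℂ, |z.im| < a → ‖lineLog β (Real.log t) φ' p₂ z‖ ≤ B) ∧
      (∀ p₁ : ℝ, Complex.exp (lineLog β (Real.log t) φ' p₂ p₁) =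
        1 + Complex.exp (((Real.log t : ℝ) : ℂ) + (φ' : ℂ) * Complex.I + 2 * β * Real.cos p₁ + 2 * β * Real.cos p₂)) :=
    fun φ' hφ' p₂ => hstrip (Real.log t) hs1 hs2 φ' hφ' p₂
  -- the pointwise circle bound
  have hpt := pointwise_circle_bound L β θ (Real.log t) FreeGasArc.Inputs.shiftedTrapezoidShift_holds
    FreeGasArc.Inputs.offArcGaussianDecay_holds ha hB hstripφ le_rfl hδ0 hδ1
    (hvar L hL1 θ hθ (Real.log t) hs1 hs2) (hvar L hL1 0 (by rw [abs_zero]; positivity) (Real.log t) hs1 hs2)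
  rw [hts] at hpt
  -- the ratio-to-log step
  have hmain := FreeGasArc.Inputs.abs_log_esymmW_sub_le (freeWeight L β θ) (freeWeight L β 0) (hwpos θ) (hwpos 0)
    ht (M := halfCount L) (by rw [hcardN]; exact hMn.le) hmode hK0 hpt hsmall
  rw [hcard] at hmain
  simp only [esymmW_eq_inputs]
  rw [← mul_sub, abs_mul, abs_two]
  linarith

/-! ## §5 Final compositions (UNCONDITIONAL) -/

/-- **The rung (unconditional since v4):** `ObsThermalStiffnessSeqCeilingAtBeta 0 0 (7/8) β 0` for every `β > 0`. -/
theorem freeGas_rung {β : ℝ} (hβ : 0 < β) : ObsThermalStiffnessSeqCeilingAtBeta 0 0 (7 / 8) β 0 :=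
  freeGas_rung_of sectorLogZFreeFactorisation_of_stub esymmLogTwistInsensitive_holds hβ

/-- **K1's literal `U = 0` twin (unconditional since v4):** `ObsThermalStiffnessSeqCeilingAtBeta 0 0 (7/8) 10 (1/8)`. -/
theorem freeGas_K1twin : ObsThermalStiffnessSeqCeilingAtBeta 0 0 (7 / 8) 10 (1 / 8) :=
  freeGas_K1twin_of' sectorLogZFreeFactorisation_of_stub esymmLogTwistInsensitive_holds

/-- The card's witness statement (unconditional since v4). -/
theorem freeGasSectorTwistInsensitive_of_stub : FreeGasSectorTwistInsensitive 0 (7 / 8) :=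
  freeGasSectorTwistInsensitive_of sectorLogZFreeFactorisation_of_stub esymmLogTwistInsensitive_holds

end Summit.Ventures.CertifiedManyBodySolver.Theorems.FreeGasArc

end
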